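import Literature.NumberTheory.Rogawski1990.UnitOrbitalIntegralInertValueTHEigenCorner                 -- ★∕pending B-p12 p842246: CORNER layer
import Literature.NumberTheory.Rogawski1990.UnitOrbitalIntegralInertValueThetaZeroAdicCompletion      -- ★ p04 p842055: the `L_w` discharge idiom (imports)
import HarnessLib

/-!
# κ = +1 VALUE, LITERAL-FREE, AT THE INERT COMPLETION `L_w`: `#Fix_{U(L_w)⧸K}(t) = phiTHn (Nv) n N` with the local frame data discharged
(Flicker (1998), Prop. 11 p. 87 ∕ Theorem 18 p. 97; Rogawski (1990) §4.9)

Topic `NumberTheory/Rogawski1990`; namespace `Literature.NumberTheory.Automorphic.UnitaryGroup`.  THEOREMS ONLY; kernel lane.  Cell `pub/hodgecm-mathlib`, road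
«N7-ns COUNT FROM FLICKER», line «N7nsCount», `stub_irredGValuePos` (:1189): the `L_w` layer of brick (γ) (LEAD F0P3a-plan (g9) T8-131) — ★ B-p12 CORNER
`natCard_fixedPoints_unitaryInt_eq_phiTHn_of_eigen_corner` at `K = L_w` (`w ∣ v` inert, `v` unramified, `2 ∉ v`), `σ_w = galAdicCompletionMap`, `J_w = placeForm Φ₃ w`, with
`hJ hd hσO hq hq1 a₀` DISCHARGED verbatim by p04 (g12)'s ★ p842055 idiom (★ `localConjDatum_adicCompletion`, ★ `mem_integer_galAdicCompletionMap`, ★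
`natCard_residueField_eq_sq_of_inert`, ★ `exists_isUnit_map_sub_of_residueHom_ne` ∘ ★ `exists_frob_ne` ∘ ★ `residueHom_galAdicCompletionMap_eq_pow`).  What remains for the
:1189 pen: `y` (`y σ_w y = −2`, ★ flicker scalars), the element `t` with its even-norm eigenvector (★ (β) p842227 + ★ (γ)-algebra p842239 through the stub's congruence),
the exponent hypotheses (★ `IsLocalNormPair.charpoly_eq`), `hfin` and the (P3) transport ((α), B-p10∕p04), and the instance `[IsAdicComplete 𝓂 𝒪_w]` (★ F0P3b-p01 p842102).
HONEST LABEL: HC_CM is proved only modulo the printed citations (2 remaining named inputs hLiu418, h413) until rung 0 closes.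

## References
* [Flicker1998UnitaryFL] Y. Z. Flicker, *Elementary proof of the fundamental lemma for a unitary group*, Canad. J. Math. 50 (1998), Prop. 11 p. 87, Theorem 18 p. 97.
* [Rogawski1990] J. D. Rogawski, *Automorphic Representations of Unitary Groups in Three Variables* (1990), §4.9 p. 55.
-/

set_option autoImplicit false

open scoped MatrixGroups WithZero Valued
open Matrix NumberField IsDedekindDomain

namespace Literature.NumberTheory.Automorphic

namespace UnitaryGroup

open Literature.NumberTheory.Automorphic.HermitianLattice
open Literature.NumberTheory.Rogawski1990.Flicker1998 (phiTHn)
open IsLocalRing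

section AdicCompletion

variable (L : Type) [Field L] [NumberField L] [IsCMField L] {v : HeightOneSpectrum (𝓞 ↥(maximalRealSubfield L))}

set_option synthInstance.maxHeartbeats 200000 in
-- the `H`-action on `H ⧸ (K^{u_m} ∩ H)` (as in ★ (F2))
/-- **`#Fix_{U(L_w)⧸K}(t) = phiTHn (Nv) n N` at an inert place** for `t ∈ U(σ_w, Φ₃)(L_w)` with an eigenvector of EVEN norm valuation, type-(2) complementary factor
(`v((tr t − u)² − 4 det t∕u) = exp(−(2N+1))`) and observable exponent `n`.  ONE INSTANCE BINDER `[IsAdicComplete 𝓂[𝒪_w] 𝒪_w]` as in ★ p842055.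
[cite: Flicker1998UnitaryFL, Prop. 11 p. 87; Theorem 18 p. 97] [cite: Rogawski1990, §4.9 Prop. 4.9.1 (b) p. 55] -/
theorem natCard_fixedPoints_unitaryInt_eq_phiTHn_of_eigen_adicCompletion (w : PlacesOver L v) (hw : IsCMField.complexConj L • w.1 = w.1)
    [IsAdicComplete (IsLocalRing.maximalIdeal 𝒪[w.1.adicCompletion L]) 𝒪[w.1.adicCompletion L]]
    (hv : Algebra.IsUnramifiedIn (𝓞 L) v.asIdeal) (h2 : (2 : 𝓞 ↥(maximalRealSubfield L)) ∉ v.asIdeal)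
    {y : w.1.adicCompletion L} (hy : y * galAdicCompletionMap (L := L) (IsCMField.complexConj L) hw y = -2)
    {t : ↥(unitaryGroupOfForm (galAdicCompletionMap (L := L) (IsCMField.complexConj L) hw)
      (placeForm (Matrix.of fun i j : Fin 3 => if i.val + j.val + 1 = 3 then (1 : L) else 0) w.1))}
    {x : Fin 3 → w.1.adicCompletion L} {u : w.1.adicCompletion L} (htx : (((t : ↥(unitaryGroupOfForm (galAdicCompletionMap (L := L) (IsCMField.complexConj L) hw)
      (placeForm (Matrix.of fun i j : Fin 3 => if i.val + j.val + 1 = 3 then (1 : L) else 0) w.1))) : GL (Fin 3) (w.1.adicCompletion L)) : Matrix (Fin 3) (Fin 3) (w.1.adicCompletion L)) *ᵥ x = u • x)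
    {k : ℤ} (hx : Valued.v (B₀ (galAdicCompletionMap (L := L) (IsCMField.complexConj L) hw) 3 x x) = WithZero.exp (2 * k))
    {N n : ℕ} (hN : Valued.v ((Matrix.trace (((t : ↥(unitaryGroupOfForm (galAdicCompletionMap (L := L) (IsCMField.complexConj L) hw)
      (placeForm (Matrix.of fun i j : Fin 3 => if i.val + j.val + 1 = 3 then (1 : L) else 0) w.1))) : GL (Fin 3) (w.1.adicCompletion L)) : Matrix (Fin 3) (Fin 3) (w.1.adicCompletion L)) - u) ^ 2 - 4 * (Matrix.det (((t : ↥(unitaryGroupOfForm (galAdicCompletionMap (L := L) (IsCMField.complexConj L) hw)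
      (placeForm (Matrix.of fun i j : Fin 3 => if i.val + j.val + 1 = 3 then (1 : L) else 0) w.1))) : GL (Fin 3) (w.1.adicCompletion L)) : Matrix (Fin 3) (Fin 3) (w.1.adicCompletion L)) / u)) = WithZero.exp (-((2 * N + 1 : ℕ) : ℤ)))
    (hn : Valued.v (u ^ 2 - (Matrix.trace (((t : ↥(unitaryGroupOfForm (galAdicCompletionMap (L := L) (IsCMField.complexConj L) hw)
      (placeForm (Matrix.of fun i j : Fin 3 => if i.val + j.val + 1 = 3 then (1 : L) else 0) w.1))) : GL (Fin 3) (w.1.adicCompletion L)) : Matrix (Fin 3) (Fin 3) (w.1.adicCompletion L)) - u) * u + Matrix.det (((t : ↥(unitaryGroupOfForm (galAdicCompletionMap (L := L) (IsCMField.complexConj L) hw)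
      (placeForm (Matrix.of fun i j : Fin 3 => if i.val + j.val + 1 = 3 then (1 : L) else 0) w.1))) : GL (Fin 3) (w.1.adicCompletion L)) : Matrix (Fin 3) (Fin 3) (w.1.adicCompletion L)) / u) = WithZero.exp (-(n : ℤ)))
    (hfin : {z : ↥(unitaryGroupOfForm (galAdicCompletionMap (L := L) (IsCMField.complexConj L) hw)
      (placeForm (Matrix.of fun i j : Fin 3 => if i.val + j.val + 1 = 3 then (1 : L) else 0) w.1)) ⧸
      unitaryInt (galAdicCompletionMap (L := L) (IsCMField.complexConj L) hw)
        (placeForm (Matrix.of fun i j : Fin 3 => if i.val + j.val + 1 = 3 then (1 : L) else 0) w.1) | t • z = z}.Finite) :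
    (Nat.card {z : ↥(unitaryGroupOfForm (galAdicCompletionMap (L := L) (IsCMField.complexConj L) hw)
      (placeForm (Matrix.of fun i j : Fin 3 => if i.val + j.val + 1 = 3 then (1 : L) else 0) w.1)) ⧸
      unitaryInt (galAdicCompletionMap (L := L) (IsCMField.complexConj L) hw)
        (placeForm (Matrix.of fun i j : Fin 3 => if i.val + j.val + 1 = 3 then (1 : L) else 0) w.1) | t • z = z} : ℚ) =
      phiTHn (Ideal.absNorm v.asIdeal) n N := by
  classical
  have hc1 : IsCMField.complexConj L ≠ 1 := IsCMField.complexConj_ne_one L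
  -- `J_w` is the antidiagonal form over `L_w`
  have hJ : placeForm (Matrix.of fun i j : Fin 3 => if i.val + j.val + 1 = 3 then (1 : L) else 0) w.1 =
      (StdForm.antidiagonal 3).over (w.1.adicCompletion L) := by
    rw [placeForm, antidiagOne_eq_over, StdForm.over_map]
  -- the local conjugation datum, `σ_w` on `𝒪`
  obtain ⟨ϖ, hd⟩ := localConjDatum_adicCompletion (IsCMField.complexConj L) hc1 v w hw hv h2
  -- THE CURRENCY BRIDGE: the `ValuativeRel` integers (home of ★ `mem_integer_galAdicCompletionMap`, ★ `natCard_residueField_eq_sq_of_inert`,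
  -- ★ `exists_isUnit_map_sub_of_residueHom_ne`) and the `Valued` integers `𝒪[L_w]` of the Flicker frame are the same subring of `L_w`
  have hO : (ValuativeRel.valuation (w.1.adicCompletion L)).integer = 𝒪[w.1.adicCompletion L] := by
    rw [integer_valuation_eq_adicCompletionIntegers]
    ext x
    simp only [ValuationSubring.mem_toSubring, HeightOneSpectrum.mem_adicCompletionIntegers, Valued.integer, Valuation.mem_integer_iff]
  have hmem : ∀ x : w.1.adicCompletion L, x ∈ (ValuativeRel.valuation (w.1.adicCompletion L)).integer ↔ x ∈ 𝒪[w.1.adicCompletion L] :=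
    fun x => by rw [hO]
  let eO : ↥(ValuativeRel.valuation (w.1.adicCompletion L)).integer ≃+* ↥𝒪[w.1.adicCompletion L] := RingEquiv.subringCongr hO
  have hσO' : ∀ x : ↥(ValuativeRel.valuation (w.1.adicCompletion L)).integer,
      galAdicCompletionMap (L := L) (IsCMField.complexConj L) hw x ∈ (ValuativeRel.valuation (w.1.adicCompletion L)).integer :=
    mem_integer_galAdicCompletionMap (IsCMField.complexConj L) v w hw
  have hσO : ∀ x : 𝒪[w.1.adicCompletion L], galAdicCompletionMap (L := L) (IsCMField.complexConj L) hw x ∈ 𝒪[w.1.adicCompletion L] :=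
    fun x => (hmem _).1 (hσO' ⟨x, (hmem _).2 x.2⟩)
  let σR : ↥(ValuativeRel.valuation (w.1.adicCompletion L)).integer →+* ↥(ValuativeRel.valuation (w.1.adicCompletion L)).integer :=
    ((galAdicCompletionMap (L := L) (IsCMField.complexConj L) hw).comp (ValuativeRel.valuation (w.1.adicCompletion L)).integer.subtype).codRestrict
      (ValuativeRel.valuation (w.1.adicCompletion L)).integer fun x => hσO' x
  let σO : 𝒪[w.1.adicCompletion L] →+* 𝒪[w.1.adicCompletion L] :=
    ((galAdicCompletionMap (L := L) (IsCMField.complexConj L) hw).comp (𝒪[w.1.adicCompletion L]).subtype).codRestrict 𝒪[w.1.adicCompletion L] fun x => hσO x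
  -- `|𝓀_w| = q²` (counted in the `ValuativeRel` presentation, moved by `eO`)
  have hqR := natCard_residueField_eq_sq_of_inert (IsCMField.complexConj L) v hc1 hv w hw
  have hq : Nat.card (ResidueField 𝒪[w.1.adicCompletion L]) = Ideal.absNorm v.asIdeal ^ 2 := by
    rw [← Nat.card_congr (IsLocalRing.ResidueField.mapEquiv eO).toEquiv, hqR, Ideal.absNorm_apply, Submodule.cardQuot_apply]
  -- an integer moved by a unit (found in the `ValuativeRel` presentation, moved by `eO`)
  obtain ⟨σk, hσk⟩ := exists_residueField_ringHom_galAdicCompletionMap (IsCMField.complexConj L) v w hw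
  letI : Fintype (ResidueField ↥(ValuativeRel.valuation (w.1.adicCompletion L)).integer) := Fintype.ofFinite _
  have hq' : Fintype.card (ResidueField ↥(ValuativeRel.valuation (w.1.adicCompletion L)).integer) = Nat.card (𝓞 ↥(maximalRealSubfield L) ⧸ v.asIdeal) ^ 2 := by
    rw [← Nat.card_eq_fintype_card, hqR]
  obtain ⟨a₀, ha₀⟩ := LocalFields.UnramifiedQuadraticNorm.exists_isUnit_map_sub_of_residueHom_ne
    (galAdicCompletionMap (L := L) (IsCMField.complexConj L) hw) (fun x => hσO' x) σk hσk
    (Literature.LinearAlgebra.Matrix.exists_frob_ne hq' σk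
      (residueHom_galAdicCompletionMap_eq_pow (IsCMField.complexConj L) v hc1 hv w hw σk (fun x => hσO' x) hσk))
  have ha₀' : IsUnit (σO (eO a₀) - eO a₀) := by
    have h := (ha₀ : IsUnit (σR a₀ - a₀)).map eO
    rw [map_sub] at h
    convert h using 2
    exact Subtype.ext rfl
  -- `1 < Nv`
  have hq1 : 1 < Ideal.absNorm v.asIdeal := by
    have h0 : Ideal.absNorm v.asIdeal ≠ 0 := fun h0 => v.ne_bot (Ideal.absNorm_eq_zero_iff.1 h0)
    have h1 : Ideal.absNorm v.asIdeal ≠ 1 := fun h1 => v.isPrime.ne_top (Ideal.absNorm_eq_one_iff.1 h1)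
    omega
  -- exponents in `ϖ`-form
  have hvpow : ∀ j : ℕ, Valued.v (ϖ ^ j) = WithZero.exp (-(j : ℤ)) := fun j => by
    rw [map_pow, hd.vϖ, ← WithZero.exp_nsmul, nsmul_eq_mul, mul_neg, mul_one]
  rw [← hvpow] at hN hn
  exact natCard_fixedPoints_unitaryInt_eq_phiTHn_of_eigen_corner (galAdicCompletionMap (L := L) (IsCMField.complexConj L) hw) hJ hd (fun x => hσO x) hy hq hq1
    (a₀ := eO a₀) ha₀' htx hx hN hn hfin

end AdicCompletion

end UnitaryGroup

end Literature.NumberTheory.Automorphic
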